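import Summits.BirchSwinnertonDyer.Rank1Residual.Additive.XMultRankZeroCyclotomicThreeX4NoLemma20
import Summits.BirchSwinnertonDyer.Rank1Residual.Additive.XMultRankZeroCyclotomicThreeX4Lemma20NoMilne
import HarnessLib

/-!
# Line V15, X4 side with Lemma 20 PROVED (`p = 3`, `K = ℚ(ζ₃)`, ranks `(0,0)`) — Milne's A73 PROVED AWAY
# (cell `b2b-bsdres`, team n1011, seat p16 GEN 11; lead R5-87 (e) (W2) = additive-p4 GEN 23 word: the
# UPPER / two-sided no-Milne twins of the additive-p4 ℚ(ζ₃) lines are the p16 lineage's; row T-MIL-CAN)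

HONEST FRAMING (cell `b2b-bsdres`, run/shared/lean/b2b/bsd-rank1-residual/, verbatim in every
file): the goal of the cell is to DELETE the COMBINATION-SHAPED residual classes of the
Birch–Swinnerton-Dyer formula for ALL analytic-rank `≤ 1` elliptic curves over `ℚ` — "full BSD
formula for every rank `≤ 1` curve in class `C`" assembled STRICTLY from published theorems — so
that the rank-`≤ 1` remainder becomes exactly the CONSTRUCTION-SHAPED classes, which are TYPED
(missing-input `Prop`s), NOT attempted. This is not "finishing BSD". Team n1011 (N10 / N11), seat p16:
research route; X1 / X3 / X4 / X10 / N10 / N11 labels and marks UNCHANGED; nothing booked. Theorems only.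

This file is `XMultRankZeroCyclotomicThreeX4NoLemma20.lean` (mathematics, census and references in THAT file's docstrings,
unchanged) with the Milne binder `hMilne : Milne1972.bsdQuotient_baseChange_quadratic_anyModel` (A73)
DELETED from every Milne-binding theorem and NOTHING added: each such theorem is re-issued under its name
with the suffix `_noMilne`, every other binder and every proof line byte-identical, every call to a
Milne-binding tree theorem redirected to its no-Milne twin (`…_noLocal` cores / `…_noMilne` Facts of the
p16 lineage); Milne-free helpers of the source file are used as landed, not re-declared. What the
additive-p4 cores read from A73 — `Ш(V_K)` finite and the `3`-adic valuation of the card identity over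
`K = ℚ(ζ₃)` — are the THEOREMS `shaFinite_baseChange_of_twist` and T-MIL-CAN FILE 4
`padicVal_card_identity_baseChange[_anyRank]_of_natAbs_discr_eq` (`|d_K| = 3`, `V` good or multiplicative
at `3`: the per-place fibre identities (T) at EVERY place — n1011-p01's T-MIL-3 H-5a with rows T-MIL-B2 /
T-A233 inside). Every other displayed hypothesis (named facts, (⊇/K) where present, census bits,
certificates) is exactly the source file's. Labels UNCHANGED; nothing booked; no mark moves.
-/

noncomputable section

open CongruenceSubgroup WeierstrassCurve NumberField IsDedekindDomain
  Literature.NumberTheory.EllipticCurves Literature.NumberTheory.EllipticCurves.ModularForms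
  Literature.NumberTheory.EllipticCurves.Rank1Residual
  Literature.NumberTheory.EllipticCurves.Rank1Residual.Typed
  Literature.NumberTheory.GaloisRepresentations

namespace Summit.BirchSwinnertonDyer.Rank1Residual.Additive

variable (V : WeierstrassCurve ℚ) [V.IsElliptic] [V.IsGloballyMinimal]
  (W : WeierstrassCurve ℚ) [W.IsElliptic] [W.IsGloballyMinimal]

/-- **Binder-free twin of `XMultCyclotomicThree.exists_padicVal_shaOrder_add_le_of_facts_of_surj_of_lemma20_noMilne`**: the same statement WITHOUT the hypothesis
`Wuthrich2014.lemma20_surjective_threeAdic_of_semistable` (now the tree theorem `…_holds`).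
[cite: GreenbergLNM1716, §4 pp. 112–113]
[cite: Wuthrich2014, Lemma 20 (p. 399)] -/
theorem XMultCyclotomicThree.exists_padicVal_shaOrder_add_le_of_facts_of_surj_noL20_noMilne
    (hKato : Wuthrich2014.kato_charIdeal_dvd_nonsplitMultiplicative_cyclotomicThree_of_surjective)
    (hGr : Greenberg1999.thm41Analogue_charValue_rankZero_numberField)
    (hGZK : rank_eq_analyticRank_of_analyticRank_le_one) (hmod : hasEntireLFunction_rat)
    (hmodD : nonempty_modularParametrizationData)
    (C : VariableChange ℚ) (hC : C • V.quadraticTwist (-(3 : ℚ)) = W)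
    (hmult : V.HasMultiplicativeReductionAtPrime 3) (hns : ¬ V.HasSplitMultiplicativeReductionAtPrime 3)
    (hsurj : Surj W 3) (hadd : Addv W 3) (hrV : V.analyticRank = 0) (hrW : W.analyticRank = 0) :
    ∃ qV qW : ℚ, shaAn V = (qV : ℂ) ∧ shaAn W = (qW : ℂ) ∧
      (padicValNat 3 V.shaOrder : ℤ) + padicValNat 3 W.shaOrder ≤ padicValRat 3 qV + padicValRat 3 qW :=
  XMultCyclotomicThree.exists_padicVal_shaOrder_add_le_of_facts_of_surj_of_lemma20_noMilne V W hKato hGr Wuthrich2014.lemma20_surjective_threeAdic_of_semistable_holds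
    hGZK hmod hmodD C hC hmult hns hsurj hadd hrV hrW

/-- **Binder-free twin of `XMultCyclotomicThree.missingUpperBoundAt_of_facts_of_surj_of_lemma20_noMilne`**: the same statement WITHOUT the hypothesis
`Wuthrich2014.lemma20_surjective_threeAdic_of_semistable` (now the tree theorem `…_holds`).
[cite: Wuthrich2014, Lemma 20 (p. 399)] -/
theorem XMultCyclotomicThree.missingUpperBoundAt_of_facts_of_surj_noL20_noMilne
    (hKato : Wuthrich2014.kato_charIdeal_dvd_nonsplitMultiplicative_cyclotomicThree_of_surjective)
    (hGr : Greenberg1999.thm41Analogue_charValue_rankZero_numberField)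
    (hGZK : rank_eq_analyticRank_of_analyticRank_le_one) (hmod : hasEntireLFunction_rat)
    (hmodD : nonempty_modularParametrizationData)
    (C : VariableChange ℚ) (hC : C • V.quadraticTwist (-(3 : ℚ)) = W)
    (hmult : V.HasMultiplicativeReductionAtPrime 3) (hns : ¬ V.HasSplitMultiplicativeReductionAtPrime 3)
    (hsurj : Surj W 3) (hadd : Addv W 3) (hrV : V.analyticRank = 0) (hrW : W.analyticRank = 0)
    {qV : ℚ} (hqV : shaAn V = (qV : ℂ)) (hv : padicValRat 3 qV ≤ 0) :
    MissingUpperBoundAt W 3 :=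
  XMultCyclotomicThree.missingUpperBoundAt_of_facts_of_surj_of_lemma20_noMilne V W hKato hGr Wuthrich2014.lemma20_surjective_threeAdic_of_semistable_holds hGZK
    hmod hmodD C hC hmult hns hsurj hadd hrV hrW hqV hv

/-- **Binder-free twin of `XMultCyclotomicThree.bsdp_of_shaAn_units_of_facts_of_surj_of_lemma20_noMilne`**: the same statement WITHOUT the hypothesis
`Wuthrich2014.lemma20_surjective_threeAdic_of_semistable` (now the tree theorem `…_holds`).
[cite: GreenbergLNM1716, §4 pp. 112–113]
[cite: Wuthrich2014, Lemma 20 (p. 399)] -/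
theorem XMultCyclotomicThree.bsdp_of_shaAn_units_of_facts_of_surj_noL20_noMilne
    (hKato : Wuthrich2014.kato_charIdeal_dvd_nonsplitMultiplicative_cyclotomicThree_of_surjective)
    (hGr : Greenberg1999.thm41Analogue_charValue_rankZero_numberField)
    (hGZK : rank_eq_analyticRank_of_analyticRank_le_one) (hmod : hasEntireLFunction_rat)
    (hmodD : nonempty_modularParametrizationData)
    (C : VariableChange ℚ) (hC : C • V.quadraticTwist (-(3 : ℚ)) = W)
    (hmult : V.HasMultiplicativeReductionAtPrime 3) (hns : ¬ V.HasSplitMultiplicativeReductionAtPrime 3)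
    (hsurj : Surj W 3) (hadd : Addv W 3) (hrV : V.analyticRank = 0) (hrW : W.analyticRank = 0)
    {qV qW : ℚ} (hqV : shaAn V = (qV : ℂ)) (hqW : shaAn W = (qW : ℂ))
    (hvV : padicValRat 3 qV = 0) (hvW : padicValRat 3 qW = 0) : BSDp W 3 ∧ BSDp V 3 :=
  XMultCyclotomicThree.bsdp_of_shaAn_units_of_facts_of_surj_of_lemma20_noMilne V W hKato hGr Wuthrich2014.lemma20_surjective_threeAdic_of_semistable_holds hGZK
    hmod hmodD C hC hmult hns hsurj hadd hrV hrW hqV hqW hvV hvW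

end Summit.BirchSwinnertonDyer.Rank1Residual.Additive

end
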